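import Literature.AlgebraicGeometry.Resolution.HilbertSamuelSemicontinuityExcellent
import Mathlib.AlgebraicGeometry.Properties
import HarnessLib

/-!
# CJS 2020, Thm. 2.33 / Lemma 2.36 on excellent schemes, with the shift `N > dim X`

Topic: `Literature/AlgebraicGeometry/Resolution`. The renderings of Cossart–Jannsen–Saito, LNM 2270,
Thm. 2.33 (1), (3) and Lemma 2.36 (a) in `HilbertSamuelSemicontinuityExcellent.lean` carry the
hypothesis `ψ_X(x) < N` for all `x` (Bennett's inequality being available in the Bennett–Hironaka
form). CJS, Def. 2.28, fix "an integer `N ≥ dim X`" (assuming `dim X` finite); since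
`ψ_X(x) ≤ dim 𝒪_{X,x} ≤ dim X`, every `N > dim X` qualifies. This file PROVES that reduction and
restates the theorems with the single hypothesis `dim X < N`:

* `Scheme.hsPsi_lt_of_dim_lt` — `dim X < N ⟹ ψ_X(x) < N` on any locally Noetherian scheme
  (`ψ_X(x) ≤ dim 𝒪_{X,x}`, and `dim 𝒪_{X,x} = coheight x ≤ dim X`, Stacks 02IZ and sobriety; the
  tree's `Scheme.hsPsi_lt_of_topologicalKrullDim_lt` of `NormalSurfaceFirstBlowupMono.lean` is the
  case of an integral `X`);
* `Scheme.hsFun_le_hsFun_of_specializes_of_isExcellent_of_dim` — **Thm. 2.33 (1)**,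
  `Scheme.isClosed_hsStratumGE_of_isExcellent_of_dim` — **Thm. 2.33 (3)**,
  `Scheme.isLocallyClosed_hsStratum_of_isExcellent_of_dim`,
  `Scheme.isClosed_hsMaxLocus_of_isExcellent_of_dim` — **Lemma 2.36 (a)**, for a (Noetherian)
  excellent scheme `X` and any `N > dim X`.

No definitions and no named facts are introduced.

## Sources

* V. Cossart, U. Jannsen, S. Saito, *Desingularization: Invariants and Strategy*, LNM 2270
  (2020), Def. 2.28, Thm. 2.33, Lemma 2.36. [CossartJannsenSaito2020]
* The Stacks Project, Tag 02IZ (`dim 𝒪_{X,x} = codim {x}`). [StacksProject]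
-/

noncomputable section

open CategoryTheory AlgebraicGeometry TopologicalSpace IsLocalRing Order
open Literature.RingTheory.HilbertSamuel

namespace Literature.AlgebraicGeometry.Resolution

universe u

variable {X : Scheme.{u}}

/-- **`dim 𝒪_{X,x} ≤ dim X`**: `dim 𝒪_{X,x}` is the coheight of `x` in the specialization order
(Stacks 02IZ), which is bounded by the Krull dimension of that order, i.e. (sobriety) of the
lattice of irreducible closed subsets. (A local copy of the tree's
`ringKrullDim_stalk_le_topologicalKrullDim` of `NormalCrossingsStrictification.lean`, whose import
closure is the alterations machinery.) [cite: StacksProject, Tag 02IZ] -/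
private theorem ringKrullDim_stalk_le_topologicalKrullDim_aux (x : X) :
    ringKrullDim (X.presheaf.stalk x) ≤ topologicalKrullDim X := by
  rw [AlgebraicGeometry.ringKrullDim_stalk_eq_coheight, topologicalKrullDim,
    Order.krullDim_eq_of_orderIso (irreducibleSetEquivPoints (α := X))]
  exact Order.coheight_le_krullDim x

/-- **`dim X < N ⟹ ψ_X(x) < N`** (`ψ_X(x) ≤ dim 𝒪_{X,x} ≤ dim X`). [cite: CossartJannsenSaito2020, Def. 2.28] -/
theorem Scheme.hsPsi_lt_of_dim_lt [IsLocallyNoetherian X] {N : ℕ}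
    (hdim : topologicalKrullDim X < N) (x : X) : Scheme.hsPsi X x < N := by
  have h1 : (Scheme.hsPsi X x : WithBot ℕ∞) ≤ ringKrullDim (X.presheaf.stalk x) :=
    minimalPrimesCodim_le_ringKrullDim (X.presheaf.stalk x)
  have h2 := (h1.trans (ringKrullDim_stalk_le_topologicalKrullDim_aux x)).trans_lt hdim
  exact_mod_cast h2

/-- **CJS Thm. 2.33 (1) on an excellent scheme, `N > dim X`**: `H_X(y) ≤ H_X(x)` for `y ⤳ x`.
[cite: CossartJannsenSaito2020, Thm. 2.33 (1)] -/
theorem Scheme.hsFun_le_hsFun_of_specializes_of_isExcellent_of_dim [IsLocallyNoetherian X]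
    (hX : Scheme.IsExcellent X) {N : ℕ} (hdim : topologicalKrullDim X < N) {x y : X} (h : y ⤳ x) :
    Scheme.hsFun X N y ≤ Scheme.hsFun X N x :=
  Scheme.hsFun_le_hsFun_of_specializes_of_isExcellent hX N h
    (Scheme.hsPsi_lt_of_dim_lt hdim x)

/-- **CJS Thm. 2.33 (3) on a Noetherian excellent scheme, `N > dim X`**: every `X(≥ ν)` is closed
(`H_X` is upper semi-continuous). [cite: CossartJannsenSaito2020, Thm. 2.33 (3)] -/
theorem Scheme.isClosed_hsStratumGE_of_isExcellent_of_dim [IsNoetherian X]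
    (hX : Scheme.IsExcellent X) {N : ℕ} (hdim : topologicalKrullDim X < N) (ν : ℕ → ℕ) :
    IsClosed (Scheme.hsStratumGE X N ν) :=
  Scheme.isClosed_hsStratumGE_of_isExcellent' hX N (Scheme.hsPsi_lt_of_dim_lt hdim) ν

/-- **CJS Lemma 2.36 (a) on a Noetherian excellent scheme, `N > dim X`**: the strata `X(ν)` are
locally closed. [cite: CossartJannsenSaito2020, Lemma 2.36 (a)] -/
theorem Scheme.isLocallyClosed_hsStratum_of_isExcellent_of_dim [IsNoetherian X]
    (hX : Scheme.IsExcellent X) {N : ℕ} (hdim : topologicalKrullDim X < N) (ν : ℕ → ℕ) :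
    IsLocallyClosed (Scheme.hsStratum X N ν) :=
  Scheme.isLocallyClosed_hsStratum_of_isExcellent hX N
    (Scheme.hsPsi_lt_of_dim_lt hdim) ν

/-- **CJS Lemma 2.36 (a)**, `N > dim X`: the closure of `X(ν)` lies in `X(≥ ν)`.
[cite: CossartJannsenSaito2020, Lemma 2.36 (a)] -/
theorem Scheme.closure_hsStratum_subset_of_isExcellent_of_dim [IsNoetherian X]
    (hX : Scheme.IsExcellent X) {N : ℕ} (hdim : topologicalKrullDim X < N) (ν : ℕ → ℕ) :
    closure (Scheme.hsStratum X N ν) ⊆ Scheme.hsStratumGE X N ν :=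
  Scheme.closure_hsStratum_subset_of_isExcellent hX N (Scheme.hsPsi_lt_of_dim_lt hdim) ν

/-- **CJS Lemma 2.36 (a)**, `N > dim X`: `X(ν)` is closed for `ν ∈ Σ_X^max`.
[cite: CossartJannsenSaito2020, Lemma 2.36 (a)] -/
theorem Scheme.isClosed_hsStratum_of_maximal_of_isExcellent_of_dim [IsNoetherian X]
    (hX : Scheme.IsExcellent X) {N : ℕ} (hdim : topologicalKrullDim X < N) {ν : ℕ → ℕ}
    (hν : Maximal (· ∈ Scheme.hsValues X N) ν) : IsClosed (Scheme.hsStratum X N ν) :=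
  Scheme.isClosed_hsStratum_of_maximal_of_isExcellent hX N (Scheme.hsPsi_lt_of_dim_lt hdim) hν

/-- **CJS Lemma 2.36 (a): the Hilbert–Samuel locus `X_max` of a Noetherian excellent scheme is
closed**, for `N > dim X`. [cite: CossartJannsenSaito2020, Lemma 2.36 (a)] -/
theorem Scheme.isClosed_hsMaxLocus_of_isExcellent_of_dim [IsNoetherian X]
    (hX : Scheme.IsExcellent X) {N : ℕ} (hdim : topologicalKrullDim X < N) :
    IsClosed (Scheme.hsMaxLocus X N) :=
  Scheme.isClosed_hsMaxLocus_of_isExcellent hX N (Scheme.hsPsi_lt_of_dim_lt hdim)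

/-- **Lemma 2.36 (b) (`Σ_X` finite) on a Noetherian excellent scheme**, for `N > dim X` (in fact
for `N ≥ ψ_X`, `Scheme.finite_hsValues_of_isExcellent`). [cite: CossartJannsenSaito2020, Lemma 2.36 (b)] -/
theorem Scheme.finite_hsValues_of_isExcellent_of_dim [IsNoetherian X]
    (hX : Scheme.IsExcellent X) {N : ℕ} (hdim : topologicalKrullDim X < N) :
    (Scheme.hsValues X N).Finite :=
  Scheme.finite_hsValues_of_isExcellent hX N fun x =>
    (Scheme.hsPsi_lt_of_dim_lt hdim x).le

end Literature.AlgebraicGeometry.Resolution
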